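import Summits.ABC.IUTFork.LDHGenuinePerImage
import HarnessLib

/-!
# `−|log(Θ)|` in the per-(slot-)image reading (P) for the GENUINE datum: the Step (v)–(viii) constant EXPLICIT in
# the input at every `d_mod`, and the comparison `vol_(P) ≤ vol_(U)` with its consequences

Record-only file (D-0012) of the abc-iut cell (campaign-S seat abc-iut-S7; abc-iut-plan ruling 2026-08-26T02:51:47Z
"(P)-object", items (b)/(c)); TAKES NO SIDE. Sequel to `LDHGenuinePerImage.lean`. Mochizuki, *Inter-universal
Teichmüller theory III* (RIMS ms May 2020), Cor. 3.12 p. 174 (reading (U)) and Step (x) p. 181 l. 2–32 (reading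
(P)); *IUT IV* (RIMS ms Apr. 2020), Thm. 1.10 Steps (iii), (v)–(viii) pp. 25–30.

* `hullEstimatePerImageOf_ofInput_explicit` — `HullEstimatePerImageOf I δ_K(I)` for EVERY genuine input (no
  slot-constancy) with the explicit constant of abc-iut-c312-d1's `hullEstimateOf_ofInput_explicit`
  (`δ_K(I) = (l+1)/4·{(1+4/l)·Σ_{p∈T(I)} (Σ_{v|p} n_v·d(K_{v̲}))/[F_mod:ℚ]·log p + (4/l)·Σ_{p∈T(I)} log p +
  (20/3)·l*·#{p ∈ T(I) : p ≤ N}}`) under the (R4)-shape tameness input only;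
* `negLogThetaPerImageNonarch_le_negLogThetaNonarch` (`vol_(P) ≤ vol_(U)` for the genuine input),
  `negLogThetaPerImage_le_negLogTheta`; hence `cor312Of_of_cor312PerImageOf` — **Cor. 3.12 in reading (P) IMPLIES
  Cor. 3.12 in reading (U)** ((P) is the STRONGER hypothesis) —, `cor312NonarchOf_of_cor312PerImageNonarchOf`,
  `hullEstimatePerImageOf_of_hullEstimateOf` (every (U)-estimate is a (P)-estimate), and at the Θ-data of a point of
  the `λ`-line `Cor22.cor312AtDatum_of_perImage`, `Cor22.hullVolumePerImageAtDatum_of_hullVolumeAtDatum`;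
* `hullEstimatePerImageOf_ofInput_explicitDelta` — in particular the unconditional (U)-constant `explicitDelta I`
  (abc-iut-S2, which carries the slot term) also bounds reading (P).
[cite: Mochizuki2012, IUTchIII Cor. 3.12 p. 174] [cite: Mochizuki2012, IUTchIII Cor. 3.12 proof Step (x) p. 181]
[cite: Mochizuki2012, IUTchIV Thm. 1.10 Steps (v)–(viii) p. 27–30] [cite: DupuyHilado2025, §3.9, §4.12]
[claim: Mochizuki2012, status: disputed] HONEST SCOPE: nothing asserts Cor. 3.12 in either reading; typed ≠ proved.
-/

noncomputable section

namespace Summit.ABC.IUTFork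

namespace DHData

open Finset Literature.IUT.LogVolume Literature.IUT.LogVolume.Thm110Local NumberField IsDedekindDomain

variable {F₀ : Type} [Field F₀] [NumberField F₀] {K : Type} [Field K] [NumberField K] [Algebra F₀ K]
variable (I : ThetaVolumeInput F₀ K)

/-! ## The constant made explicit: the canonical local data of the genuine input, every `d_mod` -/

/-- **THE COMPUTABLE HALF IN READING (P) WITH THE STEP (v)–(viii) CONSTANT EXPLICIT IN THE INPUT**, for EVERY genuine
input (no slot-constancy), under the (R4)-shape tameness input with a threshold `N` and a size `l*`:
`HullEstimatePerImageOf I δ_K(I)` with `δ_K(I) = (l+1)/4·{(1+4/l)·Σ_{p∈T(I)} (Σ_{v|p} n_v·d(K_{v̲}))/[F_mod:ℚ]·log p +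
(4/l)·Σ_{p∈T(I)} log p + (20/3)·l*·#{p ∈ T(I) : p ≤ N}}` — the constant of `hullEstimateOf_ofInput_explicit`, now
without its hypothesis `hconst`. [cite: Mochizuki2012, IUTchIV Thm. 1.10 Steps (iii), (v)–(viii) p. 25–30]
[claim: Mochizuki2012, status: disputed] -/
theorem hullEstimatePerImageOf_ofInput_explicit (N : ℕ) {lmod : ℝ} (hlmod : 0 ≤ lmod)
    (hR4 : ∀ (p : ℕ) [hp : Fact p.Prime], p ∈ I.supportPrimes → ∀ v : placesOver F₀ p,
      p - 2 < absRamificationIdx p ((I.σ.localFieldFamily p hp.out).k v) →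
      p ≤ N ∧ 3 + Real.log (absRamificationIdx p ((I.σ.localFieldFamily p hp.out).k v)) ≤ 4 * lmod) :
    I.HullEstimatePerImageOf
      (((I.X.l : ℝ) + 1) / 4 * ((1 + 4 / (I.X.l : ℝ)) *
          (∑ p ∈ I.supportPrimes, if hp : p.Prime then haveI : Fact p.Prime := ⟨hp⟩
            (∑ v : placesOver F₀ p, (localDegree F₀ v.1 : ℝ) *
              differentOrd p ((I.σ.localFieldFamily p hp).k v)) / Module.finrank ℚ F₀ * Real.log p else 0)
        + 4 / (I.X.l : ℝ) * (∑ p ∈ I.supportPrimes, Real.log p)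
        + 20 / 3 * lmod * ((I.supportPrimes.filter (· ≤ N)).card : ℝ))) := by
  classical
  -- the canonical local data at every index `p`
  let Dloc : (p : ℕ) → DstLocal (placesOver F₀ p) := fun p =>
    { lam := fun v => localDegree F₀ v.1
      lam_pos := fun v => by exact_mod_cast localDegree_pos F₀ v.1
      logDK := fun v => if hp : p.Prime then haveI : Fact p.Prime := ⟨hp⟩
        differentOrd p ((I.σ.localFieldFamily p hp).k v) * Real.log p else 0
      logDK_nonneg := fun v => by
        split_ifs with hp
        · haveI : Fact p.Prime := ⟨hp⟩
          exact mul_nonneg (differentOrd_nonneg p _) (Real.log_natCast_nonneg p)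
        · exact le_rfl
      logQ := fun v => (ofInput I).logQloc p v
      logQ_nonneg := fun v => (ofInput I).logQloc_nonneg p v
      logp := Real.log p
      logp_nonneg := Real.log_natCast_nonneg p
      iota := if p ≤ N then 1 else 0
      iota_nonneg := by split_ifs <;> norm_num }
  have hDK : ∀ (p : ℕ) [hp : Fact p.Prime], p ∈ I.supportPrimes → ∀ v : placesOver F₀ p,
      differentOrd p ((I.σ.localFieldFamily p hp.out).k v) * Real.log p ≤ (Dloc p).logDK v := by
    intro p hp _ v
    show _ ≤ (if hp : p.Prime then _ else _)
    rw [dif_pos hp.out]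
  have hR4' : ∀ (p : ℕ) [hp : Fact p.Prime], p ∈ I.supportPrimes → ∀ v : placesOver F₀ p,
      p - 2 < absRamificationIdx p ((I.σ.localFieldFamily p hp.out).k v) →
      3 + Real.log (absRamificationIdx p ((I.σ.localFieldFamily p hp.out).k v)) ≤ 4 * (Dloc p).iota * lmod := by
    intro p hp hpT v hv
    obtain ⟨hpN, hle⟩ := hR4 p hpT v hv
    show _ ≤ 4 * (if p ≤ N then (1 : ℝ) else 0) * lmod
    rw [if_pos hpN, mul_one]
    exact hle
  have h := hullEstimatePerImageOf_ofInput I Dloc hlmod hDK (fun p _ v => rfl) (fun p _ => le_rfl) hR4'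
    (fun p _ v => rfl)
  refine I.hullEstimatePerImageOf_mono h (le_of_eq ?_)
  -- identify the three sums
  have h1 : ∑ p ∈ I.supportPrimes, (Dloc p).avg (Dloc p).logDK =
      ∑ p ∈ I.supportPrimes, if hp : p.Prime then haveI : Fact p.Prime := ⟨hp⟩
        (∑ v : placesOver F₀ p, (localDegree F₀ v.1 : ℝ) *
          differentOrd p ((I.σ.localFieldFamily p hp).k v)) / Module.finrank ℚ F₀ * Real.log p else 0 := by
    refine Finset.sum_congr rfl fun p hp => ?_
    have hp' : p.Prime := I.prime_of_mem_supportPrimes hp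
    haveI : Fact p.Prime := ⟨hp'⟩
    have hDKv : ∀ v : placesOver F₀ p,
        (Dloc p).logDK v = differentOrd p ((I.σ.localFieldFamily p hp').k v) * Real.log p := by
      intro v
      show (if hp : p.Prime then _ else _) = _
      rw [dif_pos hp']
    rw [dif_pos hp', avg_eq_sum_div (Dloc p) (fun v => rfl), div_mul_eq_mul_div, Finset.sum_mul]
    congr 1
    exact Finset.sum_congr rfl fun v _ => by rw [hDKv v]; ring
  have h3 : ∑ p ∈ I.supportPrimes, (Dloc p).iota = ((I.supportPrimes.filter (· ≤ N)).card : ℝ) := by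
    show ∑ p ∈ I.supportPrimes, (if p ≤ N then (1 : ℝ) else 0) = _
    rw [Finset.sum_boole]
  rw [h1, h3]


/-! ## `vol_(P) ≤ vol_(U)` for the genuine input, and its consequences -/

/-- **`vol_(P) ≤ vol_(U)`**: `negLogThetaPerImageNonarch I ≤ negLogThetaNonarch I` — the hull of the slot images lies in
the hull of all possible images, componentwise, both admissible (`lnνL_hullUThetaSlot_le_negLogThetaDH` through the
bridges `lnνL_hullUThetaSlot_ofInput`, `negLogThetaDH_ofInput`). [cite: Mochizuki2012, IUTchIII Cor. 3.12 proof Step (x) p. 181] -/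
theorem negLogThetaPerImageNonarch_le_negLogThetaNonarch :
    I.negLogThetaPerImageNonarch ≤ I.negLogThetaNonarch := by
  rw [← lnνL_hullUThetaSlot_ofInput, ← negLogThetaDH_ofInput]
  exact lnνL_hullUThetaSlot_le_negLogThetaDH I

/-- `−|log(Θ)|_(P) ≤ −|log(Θ)|_(U)` (same archimedean summand). [cite: Mochizuki2012, IUTchIII Cor. 3.12 proof Step (x) p. 181] -/
theorem negLogThetaPerImage_le_negLogTheta : I.negLogThetaPerImage ≤ I.negLogTheta := by
  unfold ThetaVolumeInput.negLogThetaPerImage ThetaVolumeInput.negLogTheta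
  linarith [negLogThetaPerImageNonarch_le_negLogThetaNonarch I]

/-- **Cor. 3.12 in reading (P) IMPLIES Cor. 3.12 in reading (U)** for every genuine input: (P) is the STRONGER
hypothesis. [cite: Mochizuki2012, IUTchIII Cor. 3.12 p. 174] [claim: Mochizuki2012, status: disputed] -/
theorem cor312Of_of_cor312PerImageOf (h : I.Cor312PerImageOf) : I.Cor312Of :=
  I.cor312Of_of_cor312PerImageOf_of_le (negLogThetaPerImageNonarch_le_negLogThetaNonarch I) h

/-- The nonarchimedean forms compare the same way. [cite: Mochizuki2012, IUTchIII Cor. 3.12 p. 174] [claim: Mochizuki2012, status: disputed] -/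
theorem cor312NonarchOf_of_cor312PerImageNonarchOf (h : I.Cor312PerImageNonarchOf) : I.Cor312NonarchOf :=
  I.cor312NonarchOf_of_cor312PerImageNonarchOf_of_le (negLogThetaPerImageNonarch_le_negLogThetaNonarch I) h

/-- Every hull estimate in reading (U) is a hull estimate in reading (P) (same constant).
[cite: Mochizuki2012, IUTchIV Thm. 1.10 Steps (v)–(viii) p. 27–31] -/
theorem hullEstimatePerImageOf_of_hullEstimateOf {δ : ℝ} (h : I.HullEstimateOf δ) : I.HullEstimatePerImageOf δ :=
  I.hullEstimatePerImageOf_of_hullEstimateOf_of_le (negLogThetaPerImageNonarch_le_negLogThetaNonarch I) h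

/-- In particular abc-iut-S2's UNCONDITIONAL (U)-constant `explicitDelta I` (abc-iut-c312-d1's `λ_min` discrepancy,
carrying the slot term) also bounds reading (P). [cite: Mochizuki2012, IUTchIV Thm. 1.10 Steps (v)–(viii) p. 27–30] -/
theorem hullEstimatePerImageOf_ofInput_explicitDelta : I.HullEstimatePerImageOf (explicitDelta I) :=
  hullEstimatePerImageOf_of_hullEstimateOf I (hullEstimateOf_ofInput I)

end DHData

end Summit.ABC.IUTFork

/-! ## At the Θ-data of a point of the `λ`-line -/

namespace Literature.IUT.LogVolume.Cor22

open Literature.NumberTheory.DiophantineGeometry.GenEll Summit.ABC.IUTFork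

/-- **`Cor312PerImageAtDatum P l → Cor312AtDatum P l`**: at the Θ-data of `(P, l)`, Cor. 3.12 in reading (P) implies
Cor. 3.12 in reading (U) (datum by datum, `vol_(P) ≤ vol_(U)`). [cite: Mochizuki2012, IUTchIII Cor. 3.12 p. 174]
[claim: Mochizuki2012, status: disputed] -/
theorem cor312AtDatum_of_perImage {P : NFPoint} {l : ℕ} (h : Cor312PerImageAtDatum P l) : Cor312AtDatum P l := by
  intro T
  letI := T.instFieldF; letI := T.instNumberFieldF; letI := T.instFieldK; letI := T.instNumberFieldK
  letI := T.instAlgebraK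
  exact DHData.cor312Of_of_cor312PerImageOf T.I (h T)

/-- **`HullVolumeAtDatum P l δ → HullVolumePerImageAtDatum P l δ`**: every (U)-estimate at the Θ-data of `(P, l)` is a
(P)-estimate. [cite: Mochizuki2012, IUTchIV Thm. 1.10 Steps (v)–(viii) p. 27–31] -/
theorem hullVolumePerImageAtDatum_of_hullVolumeAtDatum {P : NFPoint} {l : ℕ} {δ : ℝ} (h : HullVolumeAtDatum P l δ) :
    HullVolumePerImageAtDatum P l δ := by
  intro T
  letI := T.instFieldF; letI := T.instNumberFieldF; letI := T.instFieldK; letI := T.instNumberFieldK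
  letI := T.instAlgebraK
  exact DHData.hullEstimatePerImageOf_of_hullEstimateOf T.I (h T)

end Literature.IUT.LogVolume.Cor22

end
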